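import Summits.AnomalousDissipation.AnomalousDissipation.Theorems.BaireTransferDenseLoudLerayHopfForcesReductions
import Summits.AnomalousDissipation.AnomalousDissipation.Theorems.BaireTransferDenseLoudDesignerForcesErgodicGlueV10
import HarnessLib

/-!
# Strategist census — checked signatures (crux `BaireTransfer.DenseLoudDesignerForces`, stmt-AnomalousDissipation-1143)

Companion of `Cruxes/DenseLoudDesignerForces/STRATEGY-CENSUS.md` (crux-strategist, wall-breaker pass p1,
2026-08-17).  It TYPES the objects the census argues about, so that every "signature" quoted there elaborates:

* §1 STRENGTHEN — `DenseLoudSteadyDesignerForces` (S⁺₁: the crux with STEADY classical witnesses; steady states are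
  `τ`-periodic for every `τ > 0`) and the adapter `denseLoudDesignerForces_of_steady : S⁺₁ → crux` (proved).
* §2 DECOMPOSITION D2 — `ClosingByDesignerPerturbation` (A2: at a fixed level, a force carrying a loud bounded
  Leray–Hopf solution is a limit, inside the same stock, of forces carrying loud periodic classical orbits with budgets
  relaxed by 2) and the glue `denseLoudDesignerForces_of_lh_closing : DenseLoudLerayHopfForces → A2 → crux` (proved).
* §3 DECOMPOSITION D1 — the three children of the LANDED v10 composition as NAMED Props
  (`LoudHyperbolicTrajectories` = Stub 1′, `SmoothSemiflowModel` = N, `AmbientClosing` = D) and the glue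
  `denseLoudDesignerForces_of_v10 : 1′ → N → D → crux` obtained from `Ergodic.ergodic_line_glue_v10` (p128201).

Nothing here is asserted: every `def` is a `Prop`, every theorem is an implication.  No `sorry`.
-/

noncomputable section

set_option linter.dupNamespace false

namespace Summit.AnomalousDissipation.AnomalousDissipation.Cruxes.DenseLoudDesignerForces.StrategistCensus

open scoped Topology
open Filter Set MeasureTheory
open Literature.Analysis.FunctionSpaces Literature.Analysis.FluidPDE
open Summit.AnomalousDissipation.AnomalousDissipation.Theses.BaireTransfer
open Summit.AnomalousDissipation.AnomalousDissipation.Theorems.DenseLoudDesignerForces.Negative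
open Summit.AnomalousDissipation.AnomalousDissipation.Theorems.DenseLoudLerayHopfForces
open Summit.AnomalousDissipation.AnomalousDissipation.Theorems.DenseLoudDesignerForces.Ergodic
open Literature.Dynamics.Hyperbolic

/-- Complex Fourier coefficient values. -/
local notation "ℂ³" => EuclideanSpace ℂ (Fin 3)
/-- The flat unit torus. -/
local notation "𝕋³" => UnitAddTorus (Fin 3)
/-- Velocity values. -/
local notation "ℝ³" => EuclideanSpace ℝ (Fin 3)

/-! ## §1 STRENGTHEN: steady witnesses (S⁺₁) -/

/-- The STEADY LOUD SET: coefficient vectors carrying, at some `ν ∈ (0, 1/(j+1))`, a STEADY classical solution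
`(v, q)` of NS_ν forced by `f_c` (stated on the constant space–time path, so that the crux's own functionals
`meanEnergy`, `meanDissipation` are used verbatim) with mean energy `≤ E` and mean dissipation `≥ ε`. -/
def steadyLoudSet (S : Finset (Fin 3 → ℤ)) (E ε : ℝ) (j : ℕ) : Set (↥S → ℂ³) :=
  {c | ∃ ν : ℝ, 0 < ν ∧ ν < 1 / ((j : ℝ) + 1) ∧
    ∃ (v : 𝕋³ → ℝ³) (q : 𝕋³ → ℝ),
      Torus.IsClassicalNSSolutionOn Set.univ ν (fun _ => force S c) (fun _ => v) (fun _ => q) ∧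
      meanEnergy (fun _ : ℝ => v) ≤ E ∧ ε ≤ meanDissipation ν (fun _ : ℝ => v)}

/-- **S⁺₁ — DENSE LOUD STEADY DESIGNER STATES**: the crux with steady classical witnesses. -/
def DenseLoudSteadyDesignerForces : Prop :=
  ∀ S₀ : Finset (Fin 3 → ℤ), ∃ S : Finset (Fin 3 → ℤ), S₀ ⊆ S ∧ ∃ (E ε : ℝ), 0 < ε ∧
    ∃ U : Set (↥S → ℂ³), IsOpen U ∧ U.Nonempty ∧ ∀ j : ℕ, U ⊆ closure (steadyLoudSet S E ε j)

/-- A steady witness is a `1`-periodic witness: `steadyLOUD_j ⊆ LOUD_j`. -/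
theorem steadyLoudSet_subset_loudSet (S : Finset (Fin 3 → ℤ)) (E ε : ℝ) (j : ℕ) :
    steadyLoudSet S E ε j ⊆ loudSet S E ε j := by
  rintro c ⟨ν, hν, hνj, v, q, hsol, hE, hε⟩
  exact ⟨ν, hν, hνj, 1, fun _ => v, fun _ => q, one_pos, hsol, fun _ => rfl, hE, hε⟩

/-- **Adapter S⁺₁ → crux** (trivial: steady states are periodic). -/
theorem denseLoudDesignerForces_of_steady (h : DenseLoudSteadyDesignerForces) : DenseLoudDesignerForces := by
  rw [denseLoudDesignerForces_iff]
  intro S₀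
  obtain ⟨S, hS, E, ε, hε, U, hU, hUne, hW⟩ := h S₀
  exact ⟨S, hS, E, ε, hε, U, hU, hUne, fun j =>
    (hW j).trans (closure_mono (steadyLoudSet_subset_loudSet S E ε j))⟩

/-! ## §2 DECOMPOSITION D2: Leray–Hopf loudness (stmt-1149) + closing by designer perturbation -/

/-- **A2 — CLOSING BY DESIGNER PERTURBATION** (no hyperbolicity): at every level, every force of the stock carrying
a loud bounded global Leray–Hopf solution is a limit in `P_S` of forces carrying loud PERIODIC CLASSICAL orbits with
budgets `(2E, ε/2)`.  A `C⁰`-closing lemma for the 3-D NS_ν semiflow with perturbations confined to the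
`|S|`-parameter family of steady forces. -/
def ClosingByDesignerPerturbation : Prop :=
  ∀ (S : Finset (Fin 3 → ℤ)) (E ε : ℝ) (j : ℕ), lhLoudSet S E ε j ⊆ closure (loudSet S (2 * E) (ε / 2) j)

/-- **Glue of D2**: `DenseLoudLerayHopfForces → ClosingByDesignerPerturbation → DenseLoudDesignerForces`
(`closure_mono` + `closure_closure`, budgets relaxed by 2). -/
theorem denseLoudDesignerForces_of_lh_closing (h₁ : DenseLoudLerayHopfForces)
    (h₂ : ClosingByDesignerPerturbation) : DenseLoudDesignerForces := by
  rw [denseLoudDesignerForces_iff]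
  intro S₀
  obtain ⟨S, hS, E, ε, hε, U, hU, hUne, hW⟩ := (denseLoudLerayHopfForces_iff.1 h₁) S₀
  refine ⟨S, hS, 2 * E, ε / 2, by positivity, U, hU, hUne, fun j => ?_⟩
  calc U ⊆ closure (lhLoudSet S E ε j) := hW j
    _ ⊆ closure (closure (loudSet S (2 * E) (ε / 2) j)) := closure_mono (h₂ S E ε j)
    _ = closure (loudSet S (2 * E) (ε / 2) j) := closure_closure

/-! ## §3 DECOMPOSITION D1: the landed v10 composition with NAMED children -/

/-- **Stub 1′ — LOUD HYPERBOLIC TRAJECTORIES** (physics residual of the ergodic line; named copy of the first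
hypothesis of `Ergodic.ergodic_line_glue_v10`). -/
def LoudHyperbolicTrajectories : Prop :=
  ∀ S₀ : Finset (Fin 3 → ℤ), ∃ S : Finset (Fin 3 → ℤ), S₀ ⊆ S ∧ ∃ (E ε : ℝ), 0 < ε ∧
    ∃ U : Set (↥S → ℂ³), IsOpen U ∧ U.Nonempty ∧ ∀ j : ℕ,
      U ⊆ closure {c : ↥S → ℂ³ | ∃ ν : ℝ, 0 < ν ∧ ν < 1 / ((j : ℝ) + 1) ∧
        ∃ (K : Set Hsp) (φ : ℝ → Hsp → Hsp), IsNSPhase ν (force S c) K φ ∧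
          ∃ x ∈ K, (∀ᶠ T in atTop, energyAvg φ x T ≤ E) ∧ (∃ᶠ T in atTop, ε ≤ dissipAvg ν φ x T) ∧
            ∀ μ : Measure Hsp, IsInvariantMeasure (closure ((fun t : ℝ => φ t x) '' Ici 0)) φ μ →
              Torus.ensembleEnergy μ ≤ E → ε ≤ Torus.ensembleDissipation ν μ → IsHyperbolicMeasure ν (force S c) φ μ}

/-- **N — SMOOTH SEMIFLOW MODEL** (Navier–Stokes analysis; named copy of the second hypothesis of
`Ergodic.ergodic_line_glue_v10`). -/
def SmoothSemiflowModel : Prop :=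
  ∀ {S : Finset (Fin 3 → ℤ)} {c : ↥S → ℂ³} {ν : ℝ} {K : Set Hsp} {φ : ℝ → Hsp → Hsp}
    {μ : Measure Hsp}, 0 < ν → IsNSPhase ν (force S c) K φ → IsInvariantMeasure K φ μ →
    IsHyperbolicMeasure ν (force S c) φ μ →
    ∃ (K' : Set Hsp) (φ' : ℝ → Hsp → Hsp) (Smap : Hsp →L[ℝ] Hsp) (U Λ : Set Hsp) (g : ℝ → Hsp → Hsp) (m : Measure Hsp),
      K ⊆ K' ∧ (∀ t : ℝ, 0 ≤ t → ∀ x ∈ K, φ' t x = φ t x) ∧ IsNSPhase ν (force S c) K' φ' ∧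
        IsHyperbolicSemiflowModel U Λ g m ∧ IsSmoothModelOf K' φ' μ Smap U Λ g m

/-- **D — AMBIENT CLOSING** (smooth ergodic theory in Hilbert space; named copy of the third hypothesis of
`Ergodic.ergodic_line_glue_v10`). -/
def AmbientClosing : Prop :=
  ∀ {U Λ : Set Hsp} {g : ℝ → Hsp → Hsp} {m : Measure Hsp}, IsHyperbolicSemiflowModel U Λ g m → HasAmbientClosing U Λ g m

/-- **Glue of D1** (landed, p128201): `1′ → N → D → crux`. -/
theorem denseLoudDesignerForces_of_v10 (h1 : LoudHyperbolicTrajectories) (hN : SmoothSemiflowModel)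
    (hD : AmbientClosing) : DenseLoudDesignerForces :=
  ergodic_line_glue_v10 h1 hN hD

end Summit.AnomalousDissipation.AnomalousDissipation.Cruxes.DenseLoudDesignerForces.StrategistCensus

end
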